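import Mathlib
import HarnessLib
import Summits.ValiantsHypothesis.ValiantsHypothesis.Theorems.EquivariantDialBlockGaugeLift
import Summits.ValiantsHypothesis.ValiantsHypothesis.Theorems.EquivariantDialLayersGraded

/-!
# Equivariant-dc dial: BLOCK-GAUGE COST ⟹ LAYERING COST ⟹ GRADING COST — Theorem H reduced to ONE stub,
# the equivariant block gauge (decomp-valiant workshop, lens 1, generation 16) — support file of census
# cell A; NOT a route

HONEST FRAMING.  `VP ≠ VNP` is NOT proved here and nothing in this file is progress on it.  Sorry-free SUPPORT
file of the census cell `A = EquivariantDialNode.EqHardBiPerm` (item `stmt-ValiantsHypothesis-23702`).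
Kernel-checked, no `sorry`, no axioms:
* §1 the two small permanents: `per_0 = 1` has a `Γ`-equivariant layered program of length `0`, width `1`;
  `per_1 = x₀₀` one of length `1`, width `1` (for EVERY `Γ`) — the degrees below the reach of the bordered
  block gauge (whose determinants have degree `≥ 2`).
* §2 `HasBlockGaugeRepr Γ f N` (a bordered representation `det [[ℓ, r], [c, 1 + Z]] = f`, `Z` of size `N`,
  block-gauge equivariant on `Γ`, `BlockGauge.IsEquivariant`) and the uniform cost statement
  `BlockGaugeCost H` = ARROW 1 of Theorem H: every `H_m`-equivariant affine determinantal representation of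
  `per_m` (`m ≥ 2`) of size `s` can be brought, at polynomial cost in `m + s`, into `H_m`-equivariant block gauge
  (paper sketch NODE-g13 §2 (0)–(2): corank-one normalisation + splitting of the unipotent lift cocycle by
  averaging over the finite group, given multiplicative lifts; Lean-open — THE remaining stub of the cell-A
  skeleton).
* §3 KERNEL: `BlockGaugeCost H → LayeringCost H` (`layeringCost_of_blockGaugeCost`, via arrow 2
  `BlockGauge.hasLayeredWidthLE` of `EquivariantDialBlockGaugeLift`, width `N² + N + 1 ≤ (a+1)² (m+s+1)^{2b}`)
  and hence `BlockGaugeCost H → GradingCost H` (`gradingCost_of_blockGaugeCost`, arrow 3 =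
  `EquivariantDialLayersGraded`); at the window: `BlockGaugeCost biPermSubst → (EqHardBiPerm ↔ EqHardLayeredBiPerm)`.
Census reading: no new cell, no tag change; Theorem H's Lean-open part is now exactly `BlockGaugeCost biPermSubst`.
No `instance`, no `notation`; nothing from `Literature` restated.
-/

set_option linter.dupNamespace false

namespace Summit.ValiantsHypothesis.ValiantsHypothesis.Theorems.EquivariantDialLayers

open MvPolynomial Matrix Literature.Computability.AlgebraicComplexity EquivariantDialGrading EquivariantDialNode

noncomputable section

/-! ## §1 The two small permanents -/

namespace LayeredABP

variable {σ : Type*} {k : Type*} [Field k] [Fintype σ] [DecidableEq σ]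

/-- The empty program of width one: computes `1`. -/
def constOne : LayeredABP σ k 0 1 where
  T := fun t => t.elim0
  u := fun _ => 1
  v := fun _ => 1
  linear := fun t => t.elim0

omit [Fintype σ] [DecidableEq σ] in
/-- It computes `1`. -/
theorem eval_constOne : (constOne : LayeredABP σ k 0 1).eval = 1 := by
  simp [eval, prodT, constOne, dotProduct]

/-- Every substitution lifts to the empty program (trivially). -/
def constOneLift (γ : GL σ k) : (constOne : LayeredABP σ k 0 1).Lift γ where
  R := fun _ => 1
  a := 1
  b := 1
  layer := fun t => t.elim0
  src := by simp [constOne]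
  snk := by simp [constOne]

/-- The one-edge program of width one labelled by the variable `x_i`: computes `x_i`. -/
def var (i : σ) : LayeredABP σ k 1 1 where
  T := fun _ => of fun _ _ => X i
  u := fun _ => 1
  v := fun _ => 1
  linear := fun _ _ _ => isHomogeneous_X k i

omit [Fintype σ] [DecidableEq σ] in
/-- It computes `x_i`. -/
theorem eval_var (i : σ) : (var i : LayeredABP σ k 1 1).eval = X i := by
  simp [eval, prodT, var, dotProduct, mulVec]

/-- With ONE variable `x_i` every substitution `γ` rescales `x_i` by `det γ`, and lifts: `R_0 = det γ`,
`R_1 = 1`. -/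
def varLift [Subsingleton σ] (i : σ) (γ : GL σ k) : (var i : LayeredABP σ k 1 1).Lift γ where
  R := fun t => if t = 0 then scalarGL 1 (Matrix.GeneralLinearGroup.det γ) else 1
  a := Matrix.GeneralLinearGroup.det γ
  b := 1
  layer := fun t => by
    ext a b
    have ha : a = 0 := Subsingleton.elim _ _
    have hb : b = 0 := Subsingleton.elim _ _
    subst ha hb
    have ht : t = 0 := Subsingleton.elim _ _
    subst ht
    simp [var, Matrix.linSubstEntries, Matrix.mul_apply, Matrix.GeneralLinearGroup.val_det_apply,
      Matrix.det_eq_elem_of_subsingleton _ i, Fintype.sum_subsingleton _ i, MvPolynomial.smul_eq_C_mul]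
  src := by
    funext j
    simp [var, Matrix.vecMul_diagonal]
  snk := by
    funext j
    simp [var, Fin.last]

/-- `1` has a `Γ`-equivariant layered program of length `0` and width one, for every `Γ`. -/
theorem hasLayeredWidthLE_one (Γ : Subgroup (GL σ k)) : HasLayeredWidthLE Γ (1 : MvPolynomial σ k) 0 1 :=
  ⟨constOne, fun γ _ => ⟨constOneLift γ⟩, eval_constOne⟩

/-- With one variable `x_i`, it has a `Γ`-equivariant layered program of length `1` and width one, for every
`Γ`. -/
theorem hasLayeredWidthLE_X [Subsingleton σ] (i : σ) (Γ : Subgroup (GL σ k)) :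
    HasLayeredWidthLE Γ (X i : MvPolynomial σ k) 1 1 :=
  ⟨var i, fun γ _ => ⟨varLift i γ⟩, eval_var i⟩

omit [Fintype σ] [DecidableEq σ] in
/-- `per_1 = x₀₀`. -/
theorem perPoly_fin_one : perPoly (Fin 1) k = X (0, 0) := by
  rw [perPoly, Matrix.permanent_unique]; rfl

/-- `per_0` and `per_1` have `Γ`-equivariant layered programs of width one, for every `Γ`. -/
theorem hasLayeredWidthLE_perPoly_zero (Γ : Subgroup (GL (Fin 0 × Fin 0) k)) :
    HasLayeredWidthLE Γ (perPoly (Fin 0) k) 0 1 := by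
  rw [perPoly, Matrix.permanent_isEmpty]; exact hasLayeredWidthLE_one Γ

/-- See `hasLayeredWidthLE_perPoly_zero`. -/
theorem hasLayeredWidthLE_perPoly_one (Γ : Subgroup (GL (Fin 1 × Fin 1) k)) :
    HasLayeredWidthLE Γ (perPoly (Fin 1) k) 1 1 := by
  rw [perPoly_fin_one]; exact hasLayeredWidthLE_X (0, 0) Γ

end LayeredABP

/-! ## §2 Block-gauge representations and their cost -/

section Cost

variable {σ : Type*} {k : Type*} [Field k] [Fintype σ] [DecidableEq σ]

/-- `f` has a bordered representation `det [[ℓ, r], [c, 1 + Z]] = f` with `Z` of size `N`, BLOCK-GAUGE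
EQUIVARIANT on `Γ` (`BlockGauge.IsEquivariant`: every `γ ∈ Γ` lifts block-diagonally, `g = diag(α, M)`,
`h = diag(β, M)`). -/
def HasBlockGaugeRepr (Γ : Subgroup (GL σ k)) (f : MvPolynomial σ k) (N : ℕ) : Prop :=
  ∃ B : BlockGauge σ k (Fin N), B.matrix.det = f ∧ B.IsEquivariant Γ

/-- ARROW 2 with sizes: a block-gauge representation of inner size `N` of a form of degree `d + 2` gives an
equivariant layered program of length `d + 2` and width `N² + N + 1`. -/
theorem hasLayeredWidthLE_of_hasBlockGaugeRepr [CharZero k] {Γ : Subgroup (GL σ k)} {f : MvPolynomial σ k}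
    {d N : ℕ} (hf : f.IsHomogeneous (d + 2)) (h : HasBlockGaugeRepr Γ f N) :
    HasLayeredWidthLE Γ f (d + 2) (N * N + (N + 1)) := by
  obtain ⟨B, hdet, hB⟩ := h
  simpa only [Fintype.card_sum, Fintype.card_prod, Fintype.card_fin, Fintype.card_unit] using
    B.hasLayeredWidthLE hB hf hdet

/-- **BLOCK-GAUGE COST** at the notch `H` (= ARROW 1 of Theorem H, NODE-g13 §2 (1)–(2)): every
`H_m`-equivariant affine determinantal representation of `per_m`, `m ≥ 2`, of size `s` can be brought into
`H_m`-equivariant BLOCK GAUGE of inner size `≤ a (m + s + 1)^b`, uniformly.  (NODE-g13 §2 (0)–(2) argues it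
for finite `H ≤ 𝔾_per`: corank-one normalisation `A(0) ~ diag(0, 1)` (von zur Gathen, `m ≥ 3`), then the lifts
are block-TRIANGULAR and their unipotent corners form a twisted cocycle, split by averaging over the finite
group — which needs a MULTIPLICATIVE choice of lifts (NODE-g16 §3 flags this as the delicate point);
Lean-open — the one remaining stub of the cell-A skeleton.) -/
def BlockGaugeCost (H : ∀ m : ℕ, Subgroup (GL (Fin m × Fin m) ℂ)) : Prop :=
  ∃ a b : ℕ, ∀ m s : ℕ, 2 ≤ m → HasEquivariantDetRepr (H m) (perPoly (Fin m) ℂ) s →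
    ∃ N : ℕ, N ≤ a * (m + s + 1) ^ b ∧ HasBlockGaugeRepr (H m) (perPoly (Fin m) ℂ) N

/-- Arithmetic of arrow 2: `N² + N + 1 ≤ (a+1)² (m+s+1)^{2b}` when `N ≤ a (m+s+1)^b`. -/
theorem blockGauge_cost_le {a b m s N : ℕ} (hN : N ≤ a * (m + s + 1) ^ b) :
    N * N + (N + 1) ≤ (a + 1) ^ 2 * (m + s + 1) ^ (2 * b) := by
  have h1 : 1 ≤ (m + s + 1) ^ b := Nat.one_le_pow _ _ (by omega)
  have h2 : N + 1 ≤ (a + 1) * (m + s + 1) ^ b := by nlinarith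
  calc N * N + (N + 1) ≤ (N + 1) * (N + 1) := by nlinarith
    _ ≤ (a + 1) * (m + s + 1) ^ b * ((a + 1) * (m + s + 1) ^ b) := Nat.mul_le_mul h2 h2
    _ = (a + 1) ^ 2 * (m + s + 1) ^ (2 * b) := by ring

/-! ## §3 Theorem H reduced to the block gauge -/

variable {H : ∀ m : ℕ, Subgroup (GL (Fin m × Fin m) ℂ)}

/-- **ARROWS 2 + 3 OF THEOREM H, KERNEL.**  A uniform polynomial block-gauge cost gives a uniform polynomial
layering cost: `per_0`, `per_1` by §1, `per_{d+2}` by Le Verrier's program (`EquivariantDialBlockGaugeLift`). -/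
theorem layeringCost_of_blockGaugeCost (h : BlockGaugeCost H) : LayeringCost H := by
  obtain ⟨a, b, hab⟩ := h
  refine ⟨(a + 1) ^ 2, 2 * b, fun m s hA => ?_⟩
  have hone : 1 ≤ (a + 1) ^ 2 * (m + s + 1) ^ (2 * b) :=
    Nat.one_le_iff_ne_zero.mpr (Nat.mul_ne_zero (pow_ne_zero _ (by omega)) (pow_ne_zero _ (by omega)))
  rcases m with _ | _ | d
  · exact ⟨1, hone, LayeredABP.hasLayeredWidthLE_perPoly_zero (H 0)⟩
  · exact ⟨1, hone, LayeredABP.hasLayeredWidthLE_perPoly_one (H 1)⟩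
  · obtain ⟨N, hN, hB⟩ := hab (d + 2) s (by omega) hA
    refine ⟨N * N + (N + 1), blockGauge_cost_le hN, hasLayeredWidthLE_of_hasBlockGaugeRepr ?_ hB⟩
    simpa only [Fintype.card_fin] using perPoly_isHomogeneous (n := Fin (d + 2)) (k := ℂ)

/-- **THEOREM H REDUCED TO THE BLOCK GAUGE** (KERNEL): `BlockGaugeCost H → GradingCost H`. -/
theorem gradingCost_of_blockGaugeCost (h : BlockGaugeCost H) : GradingCost H :=
  gradingCost_of_layeringCost (layeringCost_of_blockGaugeCost h)

/-- At the window: given the block-gauge cost, cell `A = EqHardBiPerm` IS the layered cell `A^lay`. -/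
theorem eqHardBiPerm_iff_layered_of_blockGaugeCost (h : BlockGaugeCost biPermSubst) :
    EqHardBiPerm ↔ EqHardLayeredBiPerm :=
  eqHardBiPerm_iff_layered_of_cost (layeringCost_of_blockGaugeCost h)

end Cost

end

end Summit.ValiantsHypothesis.ValiantsHypothesis.Theorems.EquivariantDialLayers
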